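import Summits.CriticalPhenomena.PercolationContinuityZ3.Theses.PercBudgetLadder
import Summits.CriticalPhenomena.PercolationContinuityZ3.Theorems.PinholeClosing.Negative.PinholeClosingBaseline
import Summits.CriticalPhenomena.PercolationContinuityZ3.Theorems.PercBudgetLadderPinholeClosingStubTightPocketLocal
import Summits.CriticalPhenomena.PercolationContinuityZ3.Theorems.PercBudgetLadderPinholeClosingStubTightPocketExists
import Summits.CriticalPhenomena.PercolationContinuityZ3.Theorems.PercBudgetLadderPinholeClosingStubBlockDisintegration
import Summits.CriticalPhenomena.PercolationContinuityZ3.Theorems.PercBudgetLadderPinholeClosingStubDoorKill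
import HarnessLib

/-!
# Pocket resampling for the crux `PercBudgetLadder.PinholeClosing` (stmt-CriticalPhenomena-5249) — objects; two tight pockets force the decrement

Line `pocket-resampling-liveness-mass` (idea of planner-cruxidea-stmt-CriticalPhenomena-5249-5-0; lead prover-line-stmt-CriticalPhenomena-5249-1;
skeleton `Cruxes/PinholeClosing/Lines/pocket_resampling_liveness_mass.lean`).  Bond percolation on `ℤ³` at `p_c` (`μc`), window
`box 3 n → ∂ⁱⁿ box 3 m`.  §1 OBJECTS (definitionally the inlined terms of the landed stubs `Theorems.stub_tightPocketLocal` p96747,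
`stub_tightPocketExists` p96915, `stub_blockDisintegration` p96905, `stub_doorKill` p97142): `bEv` (VERBATIM the route's budget-`k`
blocked event), `exactEv`, `openBdry`, `Admissible`, `IsTightPocket` (⊂-minimal admissible set with `≤ k+1` open boundary edges),
`hybrid` (ω on the edges touching `A`, ω' elsewhere), `revival`, `livenessMass = Σ_A 𝟙{A tight}·revival A`, `qKill = (1-p_c)^5`.
§2 cut property + submodularity of the open edge-boundary count (adapted from the ideator's sketch) ⇒ `twoPocketsDecrement`,
`tightPocket_unique`.  §3 named forms of the landed stubs.  §4 bounds and `{D > 1} ⊆ bEv k` a.s., with its def-free registered form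
`Theorems.stub_pocketTwoPockets`.  Identity / kill / reduction: `…PocketKill.lean`, `…PocketReduction.lean`.
-/

noncomputable section

namespace Summit.CriticalPhenomena.PercolationContinuityZ3.Theorems

open MeasureTheory Finset
open Literature.Probability.Percolation Literature.Probability.LatticeModels
open Summit.CriticalPhenomena.PercolationContinuityZ3.Theses
open Summit.CriticalPhenomena.PercolationContinuityZ3.Theorems.PinholeClosing.Negative
open scoped Classical

namespace PocketResampling

/-! ## §1 Objects -/

/-- The critical bond measure on ℤ³. -/
abbrev μc : Measure (BondConfig (Site 3)) := bondPercolation (zdGraph 3) (criticalProbI 3)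

/-- Budget-`k` blocked event of `box 3 n → ∂ⁱⁿ box 3 m` (verbatim the route's inlined event). -/
def bEv (k n m : ℕ) : Set (BondConfig (Site 3)) :=
  {ω : BondConfig (Site 3) | ∃ S : Finset (Sym2 (Site 3)), S.card ≤ k ∧ ¬ ∃ x ∈ box 3 n,
    ∃ y ∈ innerBoundary (zdGraph 3) (box 3 m), (ω \ (↑S : Set (Sym2 (Site 3)))) ∈ openConnIn (↑(box 3 m) : Set (Site 3)) x y}

/-- Budget exactly `k+1`. -/
def exactEv (k n m : ℕ) : Set (BondConfig (Site 3)) := bEv (k + 1) n m \ bEv k n m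

/-- Open edge-boundary count `c_ω(A)` (lattice edges with exactly one endpoint in `A` that are open). -/
def openBdry (ω : BondConfig (Site 3)) (A : Finset (Site 3)) : ℕ :=
  ((edgeBoundary (zdGraph 3) A).filter (· ∈ ω)).card

/-- Admissible source sets of the window: contain the source box, avoid the sink sphere. -/
def Admissible (n m : ℕ) (A : Finset (Site 3)) : Prop :=
  box 3 n ⊆ A ∧ A ⊆ box 3 m \ innerBoundary (zdGraph 3) (box 3 m)

/-- `A` is a TIGHT (minimal) `(k+1)`-pocket of `ω`. -/
def IsTightPocket (k n m : ℕ) (ω : BondConfig (Site 3)) (A : Finset (Site 3)) : Prop :=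
  Admissible n m A ∧ openBdry ω A ≤ k + 1 ∧
    ∀ A' : Finset (Site 3), Admissible n m A' → A' ⊂ A → k + 2 ≤ openBdry ω A'

/-- The hybrid configuration: `ω` on the edges touching `A`, `ω'` on all other edges. -/
def hybrid (A : Finset (Site 3)) (ω ω' : BondConfig (Site 3)) : BondConfig (Site 3) :=
  (ω ∩ ↑(edgesTouching (zdGraph 3) A)) ∪ (ω' \ ↑(edgesTouching (zdGraph 3) A))

/-- Revival probability `λ(A, ω)`: a fresh exterior makes the budget exactly `k+1`. -/
def revival (k n m : ℕ) (A : Finset (Site 3)) (ω : BondConfig (Site 3)) : ℝ :=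
  μc.real {ω' : BondConfig (Site 3) | hybrid A ω ω' ∈ exactEv k n m}

/-- The liveness mass `D(ω) = Σ_{A tight} λ(A, ω)`, written as a sum of indicators over ALL `A ⊆ box 3 m`
(`Set.indicator` carries its own classical decidability, so the term is definitionally stable across files). -/
def livenessMass (k n m : ℕ) (ω : BondConfig (Site 3)) : ℝ :=
  ∑ A ∈ (box 3 m).powerset, {ξ : BondConfig (Site 3) | IsTightPocket k n m ξ A}.indicator (revival k n m A) ω

/-- The kill constant `q = (1 - p_c)^5`. -/
def qKill : ℝ := (1 - ((criticalProbI 3 : unitInterval) : ℝ)) ^ 5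

/-- The crux, restated over `bEv` (definitional). -/
theorem pinholeClosing_iff_bEv :
    PercBudgetLadder.PinholeClosing ↔
      ∀ (k l : ℕ) (c : ℝ), 2 ≤ l → 0 < c → ∃ c' : ℝ, 0 < c' ∧ ∀ n : ℕ, 1 ≤ n →
        c ≤ μc.real (bEv (k + 1) n (l * n)) → c' ≤ μc.real (bEv k n (2 * l * n)) :=
  Iff.rfl

/-! ## §2 Cut property, submodularity, two pockets (adapted from `Cruxes/PinholeClosing/SketchIdeator5.lean`) -/

-- adapted from Cruxes/PinholeClosing/SketchIdeator5.lean
/-- Paths of `ω ∖ S` inside the window that start in `A` stay in `A` when every open boundary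
edge of `A` lies in `S` (lattice configurations). -/
theorem stays_of_boundary_subset {A : Finset (Site 3)} {ω : BondConfig (Site 3)}
    {S : Finset (Sym2 (Site 3))} {m : ℕ} (hω : ω ⊆ (zdGraph 3).edgeSet)
    (hS : ∀ e ∈ edgeBoundary (zdGraph 3) A, e ∈ ω → e ∈ S)
    (u v : (↑(box 3 m) : Set (Site 3)))
    (huv : ((openGraph (ω \ ↑S)).induce (↑(box 3 m) : Set (Site 3))).Reachable u v)
    (hu : (u : Site 3) ∈ A) : (v : Site 3) ∈ A := by
  rw [SimpleGraph.reachable_iff_reflTransGen] at huv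
  induction huv with
  | refl => exact hu
  | @tail b c _ hbc ih =>
    simp only [SimpleGraph.induce_adj, openGraph_adj, Set.mem_sdiff, Finset.mem_coe] at hbc
    obtain ⟨⟨hopen, hnotS⟩, _⟩ := hbc
    by_contra hc
    exact hnotS (hS _ ((mem_edgeBoundary_iff).2
      ⟨hω hopen, ⟨(b : Site 3), ih, Sym2.mem_mk_left _ _⟩, ⟨(c : Site 3), hc, Sym2.mem_mk_right _ _⟩⟩)
      hopen)

/-- **Cut property.** The open boundary edges of an admissible set form a blocking set: if
`A` is admissible with `≤ k` open boundary edges then the window is blocked at budget `k`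
(lattice configurations). -/
theorem mem_bEv_of_openBdry_le {k n m : ℕ} {ω : BondConfig (Site 3)} {A : Finset (Site 3)}
    (hω : ω ⊆ (zdGraph 3).edgeSet) (hA : Admissible n m A) (hk : openBdry ω A ≤ k) :
    ω ∈ bEv k n m := by
  refine ⟨(edgeBoundary (zdGraph 3) A).filter (· ∈ ω), hk, ?_⟩
  rintro ⟨x, hx, y, hy, hxS, hyS, hr⟩
  have hS : ∀ e ∈ edgeBoundary (zdGraph 3) A, e ∈ ω →
      e ∈ (edgeBoundary (zdGraph 3) A).filter (· ∈ ω) :=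
    fun e he heω => Finset.mem_filter.2 ⟨he, heω⟩
  have hyA : y ∈ A := stays_of_boundary_subset hω hS ⟨x, hxS⟩ ⟨y, hyS⟩ hr (hA.1 hx)
  have hy' := hA.2 hyA
  rw [Finset.mem_sdiff] at hy'
  exact hy'.2 hy

/-- Boundary membership of a lattice edge `s(x,y)` in terms of its endpoints. -/
theorem mk_mem_edgeBoundary_iff {X : Finset (Site 3)} {x y : Site 3}
    (hxy : s(x, y) ∈ (zdGraph 3).edgeSet) :
    s(x, y) ∈ edgeBoundary (zdGraph 3) X ↔ (x ∈ X ∧ y ∉ X) ∨ (x ∉ X ∧ y ∈ X) := by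
  rw [mem_edgeBoundary_iff]
  simp only [Sym2.mem_iff]
  constructor
  · rintro ⟨-, ⟨v, hv, rfl | rfl⟩, ⟨w, hw, rfl | rfl⟩⟩ <;> tauto
  · rintro (⟨hx, hy⟩ | ⟨hx, hy⟩)
    · exact ⟨hxy, ⟨x, hx, Or.inl rfl⟩, ⟨y, hy, Or.inr rfl⟩⟩
    · exact ⟨hxy, ⟨y, hy, Or.inr rfl⟩, ⟨x, hx, Or.inl rfl⟩⟩

/-- The open-boundary indicator of an edge. -/
def χ (ω : BondConfig (Site 3)) (X : Finset (Site 3)) (e : Sym2 (Site 3)) : ℕ :=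
  if e ∈ ω ∧ e ∈ edgeBoundary (zdGraph 3) X then 1 else 0

/-- Pointwise submodularity of the boundary indicator (16-case truth table). -/
theorem χ_submodular (ω : BondConfig (Site 3)) (A B : Finset (Site 3)) (e : Sym2 (Site 3)) :
    χ ω (A ∩ B) e + χ ω (A ∪ B) e ≤ χ ω A e + χ ω B e := by
  induction e using Sym2.ind with
  | _ x y =>
    by_cases he : s(x, y) ∈ (zdGraph 3).edgeSet
    · by_cases hω : s(x, y) ∈ ω
      · simp only [χ, hω, true_and, mk_mem_edgeBoundary_iff he, Finset.mem_inter, Finset.mem_union]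
        by_cases hxA : x ∈ A <;> by_cases hyA : y ∈ A <;> by_cases hxB : x ∈ B <;>
          by_cases hyB : y ∈ B <;> simp [hxA, hyA, hxB, hyB]
      · simp [χ, hω]
    · have h0 : ∀ X : Finset (Site 3), χ ω X s(x, y) = 0 := fun X => by
        simp only [χ, ite_eq_right_iff, one_ne_zero, imp_false, not_and]
        intro _ hb
        exact he ((mem_edgeBoundary_iff).1 hb).1
      simp [h0]

/-- `openBdry` as a sum of indicators over any finset of edges containing the boundary. -/
theorem openBdry_eq_sum {ω : BondConfig (Site 3)} {X : Finset (Site 3)} {T : Finset (Sym2 (Site 3))}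
    (hT : edgeBoundary (zdGraph 3) X ⊆ T) : openBdry ω X = ∑ e ∈ T, χ ω X e := by
  unfold openBdry χ
  rw [Finset.sum_ite, Finset.sum_const_zero, add_zero, Finset.sum_const, smul_eq_mul, mul_one]
  congr 1
  ext e
  simp only [Finset.mem_filter]
  constructor
  · rintro ⟨hb, hω⟩; exact ⟨hT hb, hω, hb⟩
  · rintro ⟨-, hω, hb⟩; exact ⟨hb, hω⟩

/-- **Submodularity of the open edge-boundary count** (the cut function of the open graph). -/
theorem openBdry_submodular (ω : BondConfig (Site 3)) (A B : Finset (Site 3)) :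
    openBdry ω (A ∩ B) + openBdry ω (A ∪ B) ≤ openBdry ω A + openBdry ω B := by
  set T := edgesTouching (zdGraph 3) (A ∪ B)
  rw [openBdry_eq_sum (T := T) (StubTightPocketLocal.edgeBoundary_subset_edgesTouching Finset.inter_subset_union),
    openBdry_eq_sum (T := T) (StubTightPocketLocal.edgeBoundary_subset_edgesTouching subset_rfl),
    openBdry_eq_sum (T := T) (StubTightPocketLocal.edgeBoundary_subset_edgesTouching Finset.subset_union_left),
    openBdry_eq_sum (T := T) (StubTightPocketLocal.edgeBoundary_subset_edgesTouching Finset.subset_union_right),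
    ← Finset.sum_add_distrib, ← Finset.sum_add_distrib]
  exact Finset.sum_le_sum fun e _ => χ_submodular ω A B e

/-- **Two distinct tight pockets force the decrement at the same shape**: `A ∩ B` is an admissible
proper subset of one of them, so it has `≥ k+2` open boundary edges, hence `A ∪ B` has `≤ k`
(submodularity), and the cut property applies. -/
theorem twoPocketsDecrement (k n m : ℕ) (ω : BondConfig (Site 3)) (A B : Finset (Site 3))
    (hω : ω ⊆ (zdGraph 3).edgeSet) (hA : IsTightPocket k n m ω A) (hB : IsTightPocket k n m ω B)
    (hne : A ≠ B) : ω ∈ bEv k n m := by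
  have hadmU : Admissible n m (A ∪ B) :=
    ⟨hA.1.1.trans Finset.subset_union_left, Finset.union_subset hA.1.2 hB.1.2⟩
  have hadmI : Admissible n m (A ∩ B) :=
    ⟨Finset.subset_inter hA.1.1 hB.1.1, Finset.inter_subset_left.trans hA.1.2⟩
  have hI : k + 2 ≤ openBdry ω (A ∩ B) := by
    by_cases h : A ⊆ B
    · -- then `A ⊂ B` is an admissible proper subset of the tight pocket `B`: impossible
      have hss : A ⊂ B := Finset.ssubset_iff_subset_ne.2 ⟨h, hne⟩
      have h1 := hB.2.2 A hA.1 hss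
      have h2 := hA.2.1
      omega
    · have hss : A ∩ B ⊂ A :=
        Finset.ssubset_iff_subset_ne.2 ⟨Finset.inter_subset_left, fun heq => h (Finset.inter_eq_left.1 heq)⟩
      exact hA.2.2 _ hadmI hss
  have hU : openBdry ω (A ∪ B) ≤ k := by
    have h1 := openBdry_submodular ω A B
    have h2 := hA.2.1
    have h3 := hB.2.1
    omega
  exact mem_bEv_of_openBdry_le hω hadmU hU

/-- **Uniqueness:** at exact level `k+1` two tight pockets coincide. -/
theorem tightPocket_unique {k n m : ℕ} {ω : BondConfig (Site 3)} {A B : Finset (Site 3)}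
    (hω : ω ⊆ (zdGraph 3).edgeSet) (hex : ω ∈ exactEv k n m)
    (hA : IsTightPocket k n m ω A) (hB : IsTightPocket k n m ω B) : A = B := by
  by_contra hne
  exact hex.2 (twoPocketsDecrement k n m ω A B hω hA hB hne)

/-- Hence the liveness mass exceeds `1` only on `{budget ≤ k}`: if two distinct tight pockets
exist the configuration is already in `bEv k`. -/
theorem mem_bEv_of_two_tightPockets {k n m : ℕ} {ω : BondConfig (Site 3)} {A B : Finset (Site 3)}
    (hω : ω ⊆ (zdGraph 3).edgeSet) (hA : IsTightPocket k n m ω A) (hB : IsTightPocket k n m ω B)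
    (hne : A ≠ B) : ω ∈ bEv k n m :=
  twoPocketsDecrement k n m ω A B hω hA hB hne

/-! ## §3 Named forms of the landed stubs (definitional bridges) and basic facts -/

/-- Stub 1 (locality), over the named objects. -/
theorem isTightPocket_congr_inter {k n m : ℕ} {A : Finset (Site 3)} {ω ω' : BondConfig (Site 3)}
    (h : ω ∩ (↑(edgesTouching (zdGraph 3) A) : Set (Sym2 (Site 3))) = ω' ∩ ↑(edgesTouching (zdGraph 3) A)) :
    IsTightPocket k n m ω A ↔ IsTightPocket k n m ω' A :=
  stub_tightPocketLocal.1 k n m A ω ω' h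

/-- Stub 1 (measurability of the tight-pocket event), over the named objects. -/
theorem measurableSet_isTightPocket (k n m : ℕ) (A : Finset (Site 3)) :
    MeasurableSet {ω : BondConfig (Site 3) | IsTightPocket k n m ω A} :=
  stub_tightPocketLocal.2 k n m A

/-- Stub 2 (existence of a tight pocket on the budget-`(k+1)` event), over the named objects. -/
theorem exists_isTightPocket {k n m : ℕ} {ω : BondConfig (Site 3)} (hnm : n < m)
    (hω : ω ⊆ (zdGraph 3).edgeSet) (hb : ω ∈ bEv (k + 1) n m) :
    ∃ A : Finset (Site 3), IsTightPocket k n m ω A :=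
  stub_tightPocketExists k n m ω hnm hω hb

/-- Stub 3 (block disintegration) with the block `T = edgesTouching A`, over the named objects. -/
theorem integral_mul_indicator_eq_integral_mul_hybridProb (A : Finset (Site 3))
    {φ : BondConfig (Site 3) → ℝ} {F : Set (BondConfig (Site 3))} (hφm : Measurable φ)
    (hφb : ∃ B : ℝ, ∀ ω, |φ ω| ≤ B)
    (hφT : ∀ ω, φ ω = φ (ω ∩ ↑(edgesTouching (zdGraph 3) A))) (hF : MeasurableSet F) :
    ∫ ω, φ ω * F.indicator (fun _ => (1 : ℝ)) ω ∂μc =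
      ∫ ω, φ ω * μc.real {ω' : BondConfig (Site 3) | hybrid A ω ω' ∈ F} ∂μc :=
  stub_blockDisintegration.1 (edgesTouching (zdGraph 3) A) φ F hφm hφb hφT hF

/-- Stub 3 (measurability of hybrid probabilities), over the named objects. -/
theorem measurable_hybridProb (A : Finset (Site 3)) {F : Set (BondConfig (Site 3))}
    (hF : MeasurableSet F) :
    Measurable fun ω : BondConfig (Site 3) => μc.real {ω' : BondConfig (Site 3) | hybrid A ω ω' ∈ F} :=
  stub_blockDisintegration.2 (edgesTouching (zdGraph 3) A) F hF

/-- Stub 4 (door kill), over the named objects. -/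
theorem qKill_le_hybridProb {k n l : ℕ} {A : Finset (Site 3)} {ω : BondConfig (Site 3)} (hl : 2 ≤ l)
    (hn : 1 ≤ n) (hω : ω ⊆ (zdGraph 3).edgeSet) (hA : Admissible n (l * n) A)
    (hk : openBdry ω A ≤ k + 1) :
    qKill ≤ μc.real {ω' : BondConfig (Site 3) | hybrid A ω ω' ∈ bEv k n (2 * l * n)} :=
  stub_doorKill k n l A ω hl hn hω hA hk

/-- `bEv` is measurable (named form of `Negative.measurableSet_blockedEv`). -/
theorem measurableSet_bEv (k n m : ℕ) : MeasurableSet (bEv k n m) :=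
  measurableSet_blockedEv k n m

/-- `exactEv` is measurable. -/
theorem measurableSet_exactEv (k n m : ℕ) : MeasurableSet (exactEv k n m) :=
  (measurableSet_bEv (k + 1) n m).diff (measurableSet_bEv k n m)

/-- The hybrid reads `ω` only through `ω ∩ edgesTouching A`. -/
theorem hybrid_inter (A : Finset (Site 3)) (ω ω' : BondConfig (Site 3)) :
    hybrid A (ω ∩ ↑(edgesTouching (zdGraph 3) A)) ω' = hybrid A ω ω' := by
  unfold hybrid
  rw [Set.inter_assoc, Set.inter_self]

/-- The revival probability reads `ω` only through `ω ∩ edgesTouching A`. -/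
theorem revival_inter (k n m : ℕ) (A : Finset (Site 3)) (ω : BondConfig (Site 3)) :
    revival k n m A (ω ∩ ↑(edgesTouching (zdGraph 3) A)) = revival k n m A ω := by
  unfold revival
  simp_rw [hybrid_inter]

/-- Tightness reads `ω` only through `ω ∩ edgesTouching A`. -/
theorem isTightPocket_inter {k n m : ℕ} {A : Finset (Site 3)} {ω : BondConfig (Site 3)} :
    IsTightPocket k n m (ω ∩ ↑(edgesTouching (zdGraph 3) A)) A ↔ IsTightPocket k n m ω A :=
  isTightPocket_congr_inter (by rw [Set.inter_assoc, Set.inter_self])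

/-- A tight pocket lies in the powerset of the outer box (admissibility). -/
theorem mem_powerset_of_isTightPocket {k n m : ℕ} {ω : BondConfig (Site 3)} {A : Finset (Site 3)}
    (hA : IsTightPocket k n m ω A) : A ∈ (box 3 m).powerset :=
  Finset.mem_powerset.2 (hA.1.2.trans Finset.sdiff_subset)

/-! ## §4 Bounds on the liveness mass; two tight pockets force the decrement -/

/-- C2a: `0 ≤ revival`. -/
theorem revival_nonneg (k n m : ℕ) (A : Finset (Site 3)) (ω : BondConfig (Site 3)) :
    0 ≤ revival k n m A ω :=
  measureReal_nonneg

/-- C2a: `revival ≤ 1`. -/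
theorem revival_le_one (k n m : ℕ) (A : Finset (Site 3)) (ω : BondConfig (Site 3)) :
    revival k n m A ω ≤ 1 :=
  measureReal_le_one

/-- C2b: each term of the liveness mass is nonnegative. -/
theorem term_nonneg (k n m : ℕ) (A : Finset (Site 3)) (ω : BondConfig (Site 3)) :
    0 ≤ {ξ : BondConfig (Site 3) | IsTightPocket k n m ξ A}.indicator (revival k n m A) ω :=
  Set.indicator_nonneg (fun ξ _ => revival_nonneg k n m A ξ) ω

/-- C2b: each term of the liveness mass is at most `1`. -/
theorem term_le_one (k n m : ℕ) (A : Finset (Site 3)) (ω : BondConfig (Site 3)) :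
    {ξ : BondConfig (Site 3) | IsTightPocket k n m ξ A}.indicator (revival k n m A) ω ≤ 1 := by
  by_cases h : ω ∈ {ξ : BondConfig (Site 3) | IsTightPocket k n m ξ A}
  · rw [Set.indicator_of_mem h]; exact revival_le_one k n m A ω
  · rw [Set.indicator_of_notMem h]; exact zero_le_one

/-- C2b: each term of the liveness mass has absolute value at most `1`. -/
theorem abs_term_le_one (k n m : ℕ) (A : Finset (Site 3)) (ω : BondConfig (Site 3)) :
    |{ξ : BondConfig (Site 3) | IsTightPocket k n m ξ A}.indicator (revival k n m A) ω| ≤ 1 :=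
  abs_le.2 ⟨by linarith [term_nonneg k n m A ω], term_le_one k n m A ω⟩

/-- **C2**: the liveness mass is nonnegative. -/
theorem livenessMass_nonneg (k n m : ℕ) (ω : BondConfig (Site 3)) : 0 ≤ livenessMass k n m ω :=
  Finset.sum_nonneg fun A _ => term_nonneg k n m A ω

/-- **C2**: the liveness mass is at most the number of subsets of the outer box. -/
theorem livenessMass_le (k n m : ℕ) (ω : BondConfig (Site 3)) :
    livenessMass k n m ω ≤ (2 : ℝ) ^ (box 3 m).card := by
  unfold livenessMass
  calc ∑ A ∈ (box 3 m).powerset, {ξ : BondConfig (Site 3) | IsTightPocket k n m ξ A}.indicator (revival k n m A) ω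
      ≤ ∑ A ∈ (box 3 m).powerset, (1 : ℝ) := Finset.sum_le_sum fun A _ => term_le_one k n m A ω
    _ = (2 : ℝ) ^ (box 3 m).card := by
      rw [Finset.sum_const, Finset.card_powerset, nsmul_eq_mul, mul_one]
      push_cast
      rfl

/-- C5a: if all tight pockets of `ω` coincide then `D ω ≤ 1`. -/
theorem livenessMass_le_one_of_subsingleton {k n m : ℕ} {ω : BondConfig (Site 3)}
    (h : ∀ A B : Finset (Site 3), IsTightPocket k n m ω A → IsTightPocket k n m ω B → A = B) :
    livenessMass k n m ω ≤ 1 := by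
  unfold livenessMass
  by_cases hex : ∃ A ∈ (box 3 m).powerset, IsTightPocket k n m ω A
  · obtain ⟨A₀, hA₀mem, hA₀⟩ := hex
    rw [Finset.sum_eq_single_of_mem A₀ hA₀mem]
    · exact term_le_one k n m A₀ ω
    · intro A _ hne
      exact Set.indicator_of_notMem
        (show ω ∉ {ξ : BondConfig (Site 3) | IsTightPocket k n m ξ A} from fun hA => hne (h A A₀ hA hA₀)) _
  · push Not at hex
    refine (Finset.sum_eq_zero fun A hA => ?_).trans_le zero_le_one
    exact Set.indicator_of_notMem (show ω ∉ {ξ : BondConfig (Site 3) | IsTightPocket k n m ξ A} from hex A hA) _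

/-- **C5**: `{D > 1} ⊆ bEv k` almost surely (two distinct tight pockets force the decrement). -/
theorem ae_mem_bEv_of_one_lt_livenessMass (k n m : ℕ) :
    ∀ᵐ ω ∂μc, 1 < livenessMass k n m ω → ω ∈ bEv k n m := by
  filter_upwards [ae_subset] with ω hω hlt
  by_contra hnot
  have h : ∀ A B : Finset (Site 3), IsTightPocket k n m ω A → IsTightPocket k n m ω B → A = B := by
    intro A B hA hB
    by_contra hne
    exact hnot (mem_bEv_of_two_tightPockets hω hA hB hne)
  exact absurd hlt (not_lt.2 (livenessMass_le_one_of_subsingleton h))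

end PocketResampling

/-- **Registered stub `stub_pocketTwoPockets` (def-free form of `PocketResampling.ae_mem_bEv_of_one_lt_livenessMass`):**
on `{D > 1}` there are two distinct tight pockets, hence budget `≤ k` at the same shape, almost surely. -/
theorem stub_pocketTwoPockets :
    ∀ (k n l : ℕ), 2 ≤ l → 1 ≤ n →
      ∀ᵐ ω ∂(bondPercolation (zdGraph 3) (criticalProbI 3)),
        1 < (∑ A ∈ (box 3 (l * n)).powerset,
          {ξ : BondConfig (Site 3) |
          (box 3 n ⊆ A ∧ A ⊆ box 3 (l * n) \ innerBoundary (zdGraph 3) (box 3 (l * n))) ∧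
          ((edgeBoundary (zdGraph 3) A).filter (· ∈ ξ)).card ≤ k + 1 ∧
          ∀ A' : Finset (Site 3), (box 3 n ⊆ A' ∧ A' ⊆ box 3 (l * n) \ innerBoundary (zdGraph 3) (box 3 (l * n))) →
          A' ⊂ A → k + 2 ≤ ((edgeBoundary (zdGraph 3) A').filter (· ∈ ξ)).card}.indicator
          (fun ξ : BondConfig (Site 3) => (bondPercolation (zdGraph 3) (criticalProbI 3)).real
          {ω' : BondConfig (Site 3) |
          (ξ ∩ ↑(edgesTouching (zdGraph 3) A)) ∪ (ω' \ ↑(edgesTouching (zdGraph 3) A)) ∈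
          {ζ : BondConfig (Site 3) | ∃ S : Finset (Sym2 (Site 3)), S.card ≤ k + 1 ∧ ¬ ∃ x ∈ box 3 n,
          ∃ y ∈ innerBoundary (zdGraph 3) (box 3 (l * n)),
          (ζ \ (↑S : Set (Sym2 (Site 3)))) ∈ openConnIn (↑(box 3 (l * n)) : Set (Site 3)) x y} \
          {ζ : BondConfig (Site 3) | ∃ S : Finset (Sym2 (Site 3)), S.card ≤ k ∧ ¬ ∃ x ∈ box 3 n,
          ∃ y ∈ innerBoundary (zdGraph 3) (box 3 (l * n)),
          (ζ \ (↑S : Set (Sym2 (Site 3)))) ∈ openConnIn (↑(box 3 (l * n)) : Set (Site 3)) x y}})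
          ω) →
        ω ∈ {ζ : BondConfig (Site 3) | ∃ S : Finset (Sym2 (Site 3)), S.card ≤ k ∧ ¬ ∃ x ∈ box 3 n,
            ∃ y ∈ innerBoundary (zdGraph 3) (box 3 (l * n)),
              (ζ \ (↑S : Set (Sym2 (Site 3)))) ∈ openConnIn (↑(box 3 (l * n)) : Set (Site 3)) x y} :=
  fun k n l _hl _hn => PocketResampling.ae_mem_bEv_of_one_lt_livenessMass k n (l * n)

end Summit.CriticalPhenomena.PercolationContinuityZ3.Theorems
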